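import Summits.HubbardSuperconductivity.HubbardSuperconductivity.Theses.InfiniteVolumeFirst
import Summits.HubbardSuperconductivity.HubbardSuperconductivity.Theorems.InfiniteVolumeFirstTightnessExchange
import Summits.HubbardSuperconductivity.HubbardSuperconductivity.Theorems.NoGoNogoThesis
import Literature.MathematicalPhysics.QuantumLattice.HubbardPairDensityCouplingFloor

/-!
# `NoNormalLimitState` (crux stmt-HubbardSuperconductivity-18533, route `InfiniteVolumeFirst`):
# the condensate atom must vanish with the coupling — no `U`-uniform atom floor for tight families
# (negative-side support, refuter crux-disprover seat; no proposition is defined here)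

The crux asks, at one `δ` and cofinally small `U ∈ (0,U₀)`, that every pointwise limit `C` of the
translation-averaged `d`-wave pair correlations of every admissible sector ground-state family has
a positive atom `liminf_R R⁻⁴ Σ_{x,y∈[0,R)²} C(x-y) > 0` — positivity PER sequence, the atom may
depend on `U`. This file shows it MUST:

* `liminf_boxAvg_le_of_tight_of_lro_le` — QUANTITATIVE EXCHANGE (the Fejér bound of the landed
  `TightnessExchange`, `tightnessExchange_fejer_bound`, with a finite LRO ceiling): tight window tails
  and `LRO_{2k} ≤ c` eventually force every pointwise limit (along even sides) to have atom `≤ c`.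
* `liminf_boxAvg_le_of_small_coupling` — the tree's a-priori coupling floor
  (`re_expect_pairField_dWave_lt_of_groundStateInSector`: a sector ground state with
  `Re⟨ψ,Δ_dᴴΔ_dψ⟩ ≥ cL⁴` forces `4(min(c,1)/48)⁶ ≤ U`) moved to the limit: at
  `0 ≤ U < 4(min(c,1)/48)⁶` EVERY tight admissible family (any `δ ≥ -1`) has ALL limit atoms `≤ c`.
  Contrapositive reading for provers: an atom `a` exhibited at coupling `U` needs
  `U ≥ 4(min(a,1)/48)⁶`; for tight families the crux's atom is `≤ 48 (U/4)^{1/6}`.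
* `exists_convergent_subseq` — along the even sides a pointwise convergent subsequence of the
  translation-averaged correlations always exists (`|C_L| ≤ C_d²`, compact cube, diagonal argument),
  so the crux's conclusion clause is never idle.
* `noNormalLimitState_uniformFloor_false_of_noInfraredPileUp` — MODULO the route's own rank-3 crux
  `NoInfraredPileUp` (tightness at weak coupling), the strengthening of the crux with the floor `a`
  chosen BEFORE `U` (`∃ δ ∃ a > 0 ∀ U₀ ∃ U ∈ (0,U₀) … a ≤ atom`) is FALSE. So a proof's witness has
  the shape `a = a(U) → 0⁺` (BCS: `a ~ e^{-2/(αρU²)}`; barrier `PerturbativeInvisibilityOfPairing`).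
  Unconditionally (without tightness) the same conclusion would follow from a WINDOW version of the
  free pairing-cost estimate, not in the tree (recorded as a near-miss in the crux's `Disproof.lean`).

Companion: `Negative/ZeroCouplingEndpoint.lean` (`U = 0` endpoint of the matrix is false at every
doping). Compare `LowEnergyRigidity/Negative/NoUniformFloorNearZeroCoupling` (finite-volume
`κ`-window analogue for crux stmt-1892). This file does NOT refute the crux.

Sources: T. Kennedy, E. H. Lieb, B. S. Shastry, PRL 61 (1988) 2582 (Fourier modes, sum rule);
S. Friedli, Y. Velenik (2017) §3.7.2, §10.4; J. Bardeen, L. N. Cooper, J. R. Schrieffer, Phys. Rev.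
108 (1957) 1175, §II; H. Tasaki (2020) §2.2 (variational principle). Folklore finite-dimensional /
elementary-analysis statements.
-/

noncomputable section

-- the mandated namespace repeats `HubbardSuperconductivity` (single-problem summit, D-0017)
set_option linter.dupNamespace false

namespace Summit.HubbardSuperconductivity.HubbardSuperconductivity.Theorems.NoNormalLimitState.Negative

open Literature.MathematicalPhysics.QuantumLattice Literature.Probability.LatticeModels Matrix Finset
  Filter
open Summit.HubbardSuperconductivity.HubbardSuperconductivity.Theorems
  (tightnessExchange_abs_corrAvg_le tightnessExchange_fejer_bound)
open scoped ComplexConjugate ComplexOrder Topology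

/-- **Quantitative exchange** (the Fejér bound of the landed `TightnessExchange` proof, run with a
finite LRO ceiling instead of `LRO → 0`). For a family `ψ` normalised at even sides with tight
window tails, if the long-range-order terms along the even sides are eventually `≤ c`, then EVERY
pointwise limit `C` (along strictly increasing even sides) has atom
`liminf_R R⁻⁴ Σ_{x,y∈[0,R)²} C(x-y) ≤ c`: `R⁻⁴ Σ C_L(x-y) ≤ LRO_L + L⁻²Σ_{window}S_L + 2π²C_d²/(R²ε²)`
(`tightnessExchange_fejer_bound`), `j → ∞` then `R → ∞` then `η → 0`.
Kennedy–Lieb–Shastry, PRL 61 (1988) 2582; Friedli–Velenik (2017) §10.4. [folklore] -/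
theorem liminf_boxAvg_le_of_tight_of_lro_le (ψ : ∀ L, Fock (Orb (FermionTorus 2 L)))
    (hnorm : ∀ L, Even L → star (ψ L) ⬝ᵥ ψ L = 1)
    (htight : ∀ η : ℝ, 0 < η → ∃ ε : ℝ, 0 < ε ∧ ∃ L₀ : ℕ, ∀ (L : ℕ) [NeZero L], Even L → L₀ ≤ L →
      (∑ m : Fin 2 → ZMod L, if m ≠ 0 ∧ momentumNormSq L m ≤ ε ^ 2 then
        pairStructureFactor dWaveFormFactor L (ψ L) m else 0) ≤ η * (L : ℝ) ^ 2)
    {c : ℝ} (hlro : ∀ᶠ k : ℕ in atTop,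
      (∑ x ∈ halfOpenBox 2 (2 * k), ∑ y ∈ halfOpenBox 2 (2 * k),
          torusPullback (pairFieldCorr dWaveFormFactor ψ) (2 * k) x y) /
        ((halfOpenBox 2 (2 * k)).card : ℝ) ^ 2 ≤ c)
    (Ls : ℕ → ℕ) (C : Site 2 → ℝ) (hLs : StrictMono Ls) (heven : ∀ j, Even (Ls j))
    (hconv : ∀ x : Site 2, Tendsto (fun j : ℕ => (∑ y ∈ halfOpenBox 2 (Ls j),
      torusPullback (pairFieldCorr dWaveFormFactor ψ) (Ls j) (x + y) y) / ((Ls j : ℕ) : ℝ) ^ 2)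
      atTop (𝓝 (C x))) :
    liminf (fun R : ℕ => (∑ x ∈ halfOpenBox 2 R, ∑ y ∈ halfOpenBox 2 R, C (x - y)) /
      ((R : ℕ) : ℝ) ^ 4) atTop ≤ c := by
  -- the constant `C_d²`
  obtain ⟨B, hB⟩ : ∃ B : ℝ, B = (∑ e ∈ insert (0 : Site 2) unitSteps,
      ‖((dWaveFormFactor e / Real.sqrt 2 : ℝ) : ℂ)‖ * 2) ^ 2 := ⟨_, rfl⟩
  have hB0 : 0 ≤ B := by rw [hB]; positivity
  -- the long-range-order sequence and the translation-averaged pair correlations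
  obtain ⟨u, hu⟩ : ∃ u : ℕ → ℝ, ∀ L, u L = (∑ x ∈ halfOpenBox 2 L, ∑ y ∈ halfOpenBox 2 L,
      torusPullback (pairFieldCorr dWaveFormFactor ψ) L x y) / ((halfOpenBox 2 L).card : ℝ) ^ 2 :=
    ⟨_, fun _ => rfl⟩
  obtain ⟨Cavg, hCavg⟩ : ∃ Cavg : ℕ → Site 2 → ℝ, ∀ L x, Cavg L x =
      (∑ y ∈ halfOpenBox 2 L, torusPullback (pairFieldCorr dWaveFormFactor ψ) L (x + y) y) /
        ((L : ℕ) : ℝ) ^ 2 := ⟨_, fun _ _ => rfl⟩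
  have hCB : ∀ j x, |Cavg (Ls j) x| ≤ B := fun j x => by
    rw [hCavg, hB]; exact tightnessExchange_abs_corrAvg_le ψ _ (hnorm _ (heven j)) x
  have hconv' : ∀ x : Site 2, Tendsto (fun j => Cavg (Ls j) x) atTop (𝓝 (C x)) := fun x => by
    simpa only [hCavg] using hconv x
  have hCbd : ∀ x, |C x| ≤ B := fun x =>
    le_of_tendsto ((continuous_abs.tendsto _).comp (hconv' x)) (Eventually.of_forall fun j => hCB j x)
  -- the box averages of the limit
  obtain ⟨b, hb⟩ : ∃ b : ℕ → ℝ, ∀ R, b R = (∑ x ∈ halfOpenBox 2 R, ∑ y ∈ halfOpenBox 2 R,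
      C (x - y)) / ((R : ℕ) : ℝ) ^ 4 := ⟨_, fun _ => rfl⟩
  have hfun : (fun R : ℕ => (∑ x ∈ halfOpenBox 2 R, ∑ y ∈ halfOpenBox 2 R, C (x - y)) /
      ((R : ℕ) : ℝ) ^ 4) = b := funext fun R => (hb R).symm
  rw [hfun]
  have hb_low : ∀ R, -B ≤ b R := by
    intro R
    have habs : |b R| ≤ B := by
      rw [hb, abs_div, abs_of_nonneg (by positivity : (0 : ℝ) ≤ ((R : ℕ) : ℝ) ^ 4)]
      rcases Nat.eq_zero_or_pos R with rfl | hRpos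
      · simpa using hB0
      · rw [div_le_iff₀ (by positivity)]
        calc |∑ x ∈ halfOpenBox 2 R, ∑ y ∈ halfOpenBox 2 R, C (x - y)|
            ≤ ∑ x ∈ halfOpenBox 2 R, |∑ y ∈ halfOpenBox 2 R, C (x - y)| :=
              Finset.abs_sum_le_sum_abs _ _
          _ ≤ ∑ x ∈ halfOpenBox 2 R, ∑ y ∈ halfOpenBox 2 R, |C (x - y)| :=
              Finset.sum_le_sum fun x _ => Finset.abs_sum_le_sum_abs _ _
          _ ≤ ∑ x ∈ halfOpenBox 2 R, ∑ y ∈ halfOpenBox 2 R, B :=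
              Finset.sum_le_sum fun x _ => Finset.sum_le_sum fun y _ => hCbd _
          _ = B * ((R : ℕ) : ℝ) ^ 4 := by
              rw [Finset.sum_const, Finset.sum_const, card_halfOpenBox, smul_smul, nsmul_eq_mul]
              push_cast
              ring
    exact (abs_le.1 habs).1
  -- along `Ls` the LRO terms are eventually `≤ c`
  have hu_ev : ∀ᶠ j in atTop, u (Ls j) ≤ c := by
    have hdiv : Tendsto (fun j => Ls j / 2) atTop atTop := by
      refine tendsto_atTop_atTop.2 fun n => ⟨2 * n, fun j hj => ?_⟩
      have h1 : j ≤ Ls j := hLs.id_le j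
      omega
    filter_upwards [hdiv.eventually hlro] with j hj
    rw [Nat.two_mul_div_two_of_even (heven j)] at hj
    rwa [hu]
  -- for every `η > 0` the atom is at most `c + 2η`
  have hkey : ∀ η : ℝ, 0 < η → liminf b atTop ≤ c + 2 * η := by
    intro η hη
    obtain ⟨ε, hε, L₀, hL₀⟩ := htight η hη
    have hR : ∀ R : ℕ, 0 < R → b R ≤ c + η + 2 * Real.pi ^ 2 * B / ((R : ℝ) ^ 2 * ε ^ 2) := by
      intro R hRpos
      have hbj : Tendsto (fun j => (∑ x ∈ halfOpenBox 2 R, ∑ y ∈ halfOpenBox 2 R,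
          Cavg (Ls j) (x - y)) / ((R : ℕ) : ℝ) ^ 4) atTop (𝓝 (b R)) := by
        rw [hb]
        exact (tendsto_finsetSum _ fun x _ => tendsto_finsetSum _ fun y _ =>
          hconv' (x - y)).div_const _
      refine le_of_tendsto hbj ?_
      have hev : ∀ᶠ j in atTop, max L₀ 1 ≤ Ls j := hLs.tendsto_atTop.eventually_ge_atTop _
      filter_upwards [hev, hu_ev] with j hj huj
      obtain ⟨n, hn⟩ : ∃ n, Ls j = n + 1 := ⟨Ls j - 1, by omega⟩
      have hevn : Even (n + 1) := hn ▸ heven j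
      have hψn : star (ψ (n + 1)) ⬝ᵥ ψ (n + 1) = 1 := hnorm (n + 1) hevn
      have hwin := hL₀ (n + 1) hevn (by omega)
      have hwin' : (∑ m : TorusSite 2 (n + 1), if m ≠ 0 ∧ momentumNormSq (n + 1) m ≤ ε ^ 2 then
          pairStructureFactor dWaveFormFactor (n + 1) (ψ (n + 1)) m else 0) /
            ((n + 1 : ℕ) : ℝ) ^ 2 ≤ η := by rwa [div_le_iff₀ (by positivity)]
      have hf := tightnessExchange_fejer_bound ψ n hψn R hRpos ε hε
      rw [← hB, ← hu] at hf
      rw [hn] at huj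
      rw [hn]
      simp only [hCavg]
      linarith
    have htail : Tendsto (fun R : ℕ => 2 * Real.pi ^ 2 * B / ((R : ℝ) ^ 2 * ε ^ 2)) atTop
        (𝓝 0) := by
      refine tendsto_const_nhds.div_atTop ?_
      exact ((tendsto_pow_atTop two_ne_zero).comp tendsto_natCast_atTop_atTop).atTop_mul_const
        (pow_pos hε 2)
    have hev : ∀ᶠ R : ℕ in atTop, b R ≤ c + 2 * η := by
      filter_upwards [htail.eventually_le_const hη, eventually_gt_atTop 0] with R h1 h2
      linarith [hR R h2]
    exact liminf_le_of_frequently_le hev.frequently (isBoundedUnder_of ⟨-B, fun R => hb_low R⟩)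
  refine le_of_forall_pos_lt_add fun η hη => ?_
  have h := hkey (η / 4) (by positivity)
  linarith

/-- **Weak repulsion caps the atom of tight families** (the tree's coupling floor
`HubbardPairDensityCouplingFloor`, moved to the limit by the quantitative exchange). For `c > 0` and
`0 ≤ U < 4·(min(c,1)/48)⁶`, every admissible family at `(δ ≥ -1, U)` whose window tails are tight
has ALL its pointwise limits with atom `≤ c`: a sector ground state with `Re⟨ψ,Δ_dᴴΔ_dψ⟩ ≥ cL⁴`
would force `4(min(c,1)/48)⁶ ≤ U` (`re_expect_pairField_dWave_lt_of_groundStateInSector`), so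
`LRO_L < c` for `L ≥ ⌈384/c⌉ + 3`. Read contrapositively: an atom `a` seen at coupling `U` needs
`U ≥ 4(min(a,1)/48)⁶` — the crux's atom must vanish as `U → 0⁺` (for tight families at least as
fast as `48·(U/4)^{1/6}`). Bardeen–Cooper–Schrieffer (1957) §II; Tasaki (2020) §2.2. [folklore] -/
theorem liminf_boxAvg_le_of_small_coupling {c U δ : ℝ} (hc : 0 < c) (hU0 : 0 ≤ U)
    (hU : U < 4 * (min c 1 / 48) ^ 6) (hδ : -1 ≤ δ) {N : ℕ → ℕ}
    {ψ : ∀ L, Fock (Orb (FermionTorus 2 L))} (hadm : (∀ L, Even L → N L = 2 * ⌊(1 - δ) * (L : ℝ) ^ 2 / 2⌋₊ ∧ star (ψ L) ⬝ᵥ ψ L = 1 ∧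
        IsGroundStateInSector (hubbardTorus 2 L 1 U) (N L) 0 (ψ L)))
    (htight : ∀ η : ℝ, 0 < η → ∃ ε : ℝ, 0 < ε ∧ ∃ L₀ : ℕ, ∀ (L : ℕ) [NeZero L], Even L → L₀ ≤ L →
      (∑ m : Fin 2 → ZMod L, if m ≠ 0 ∧ momentumNormSq L m ≤ ε ^ 2 then
        pairStructureFactor dWaveFormFactor L (ψ L) m else 0) ≤ η * (L : ℝ) ^ 2)
    (Ls : ℕ → ℕ) (C : Site 2 → ℝ) (hLs : StrictMono Ls) (heven : ∀ j, Even (Ls j))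
    (hconv : ∀ x : Site 2, Tendsto (fun j : ℕ => (∑ y ∈ halfOpenBox 2 (Ls j),
      torusPullback (pairFieldCorr dWaveFormFactor ψ) (Ls j) (x + y) y) / ((Ls j : ℕ) : ℝ) ^ 2)
      atTop (𝓝 (C x))) :
    liminf (fun R : ℕ => (∑ x ∈ halfOpenBox 2 R, ∑ y ∈ halfOpenBox 2 R, C (x - y)) /
      ((R : ℕ) : ℝ) ^ 4) atTop ≤ c := by
  refine liminf_boxAvg_le_of_tight_of_lro_le ψ (fun L hL => (hadm L hL).2.1) htight ?_ Ls C hLs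
    heven hconv
  filter_upwards [eventually_ge_atTop (⌈384 / c⌉₊ + 3)] with k hk
  obtain ⟨n, hn⟩ : ∃ n, 2 * k = n + 1 := ⟨2 * k - 1, by omega⟩
  have hevn : Even (n + 1) := hn ▸ even_two_mul k
  obtain ⟨hN, h1, hgs⟩ := hadm (n + 1) hevn
  rw [hN] at hgs
  have hle : ⌊(1 - δ) * ((n + 1 : ℕ) : ℝ) ^ 2 / 2⌋₊ ≤ (n + 1) ^ 2 :=
    Summit.HubbardSuperconductivity.NoGo.floor_pairNumber_le δ hδ (n + 1)
  have hlt := re_expect_pairField_dWave_lt_of_groundStateInSector hc hU0 hU (L := n + 1)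
    (by omega) hle hgs h1
  rw [hn, torusLROSeq_pairFieldCorr_succ]
  have hpos : (0 : ℝ) < ((n + 1 : ℕ) : ℝ) ^ 4 := by positivity
  rw [div_le_iff₀ hpos]
  exact hlt.le

/-- **A convergent subsequence always exists** (diagonal argument: `|C_L(x)| ≤ C_d²`, the cube
`[-C_d², C_d²]^{ℤ²}` is compact and first countable). So the conclusion clause of the crux is never
idle for an admissible family: along the even sides there IS a pointwise limit to test. [folklore] -/
theorem exists_convergent_subseq (ψ : ∀ L, Fock (Orb (FermionTorus 2 L)))
    (hnorm : ∀ L, Even L → star (ψ L) ⬝ᵥ ψ L = 1) :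
    ∃ (Ls : ℕ → ℕ) (C : Site 2 → ℝ), StrictMono Ls ∧ (∀ j, Even (Ls j)) ∧
      ∀ x : Site 2, Tendsto (fun j : ℕ => (∑ y ∈ halfOpenBox 2 (Ls j),
        torusPullback (pairFieldCorr dWaveFormFactor ψ) (Ls j) (x + y) y) / ((Ls j : ℕ) : ℝ) ^ 2)
        atTop (𝓝 (C x)) := by
  obtain ⟨B, hB⟩ : ∃ B : ℝ, B = (∑ e ∈ insert (0 : Site 2) unitSteps,
      ‖((dWaveFormFactor e / Real.sqrt 2 : ℝ) : ℂ)‖ * 2) ^ 2 := ⟨_, rfl⟩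
  obtain ⟨Cavg, hCavg⟩ : ∃ Cavg : ℕ → Site 2 → ℝ, ∀ L x, Cavg L x =
      (∑ y ∈ halfOpenBox 2 L, torusPullback (pairFieldCorr dWaveFormFactor ψ) L (x + y) y) /
        ((L : ℕ) : ℝ) ^ 2 := ⟨_, fun _ _ => rfl⟩
  have hCB : ∀ k x, |Cavg (2 * k) x| ≤ B := fun k x => by
    rw [hCavg, hB]; exact tightnessExchange_abs_corrAvg_le ψ _ (hnorm _ (even_two_mul k)) x
  obtain ⟨K, hK⟩ : ∃ K : Set (Site 2 → ℝ), K = Set.pi Set.univ fun _ => Set.Icc (-B) B :=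
    ⟨_, rfl⟩
  have hKc : IsCompact K := hK ▸ isCompact_univ_pi fun _ => isCompact_Icc
  have hmem : ∀ k, (fun x => Cavg (2 * k) x) ∈ K := fun k =>
    hK ▸ Set.mem_univ_pi.2 fun x => abs_le.1 (hCB k x)
  obtain ⟨C, -, φ, hφ, hconv⟩ := hKc.tendsto_subseq hmem
  refine ⟨fun j => 2 * φ j, C, fun a b hab => ?_, fun j => even_two_mul _, fun x => ?_⟩
  · have h := hφ hab
    dsimp only
    omega
  · have h := tendsto_pi_nhds.1 hconv x
    simpa only [Function.comp_def, hCavg] using h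

/-- **The atom floor must be chosen AFTER the coupling** (modulo the sibling crux
`NoInfraredPileUp`, stmt-18534, which supplies tightness of admissible families at weak coupling):
`NoInfraredPileUp → ¬ (∃ δ ∃ a > 0 ∀ U₀ ∃ U ∈ (0,U₀), every admissible family's limit atoms ≥ a)`. Given `δ` and `a`, take `c = a/2` and a
coupling `U` below both the tightness threshold `U₁(δ)` and `4(min(c,1)/48)⁶`; an admissible family
exists (`NoGo.exists_groundStateInSector_seq`), is tight, and has a convergent subsequence (`exists_convergent_subseq`)
whose limit atom is `≤ a/2` (`liminf_boxAvg_le_of_small_coupling`) — against the floor `a`. So in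
any proof of the crux the atom is `a(U) → 0⁺`; a witness shape with `a` before `U` contradicts the
route's own rank-3 crux. Compare `LowEnergyRigidity/Negative/NoUniformFloorNearZeroCoupling`
(finite-volume `κ`-window version). [folklore] -/
theorem noNormalLimitState_uniformFloor_false_of_noInfraredPileUp
    (hT : Summit.HubbardSuperconductivity.HubbardSuperconductivity.Theses.InfiniteVolumeFirst.NoInfraredPileUp) :
    ¬ (∃ δ ∈ Set.Ioo (0:ℝ) (1 / 2), ∃ a : ℝ, 0 < a ∧ ∀ U₀ : ℝ, 0 < U₀ → ∃ U ∈ Set.Ioo (0:ℝ) U₀,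
      ∀ (N : ℕ → ℕ) (ψ : ∀ L, Fock (Orb (FermionTorus 2 L))),
      (∀ L, Even L → N L = 2 * ⌊(1 - δ) * (L : ℝ) ^ 2 / 2⌋₊ ∧ star (ψ L) ⬝ᵥ ψ L = 1 ∧
        IsGroundStateInSector (hubbardTorus 2 L 1 U) (N L) 0 (ψ L)) →
      ∀ (Ls : ℕ → ℕ) (C : Site 2 → ℝ), StrictMono Ls → (∀ j, Even (Ls j)) →
        (∀ x : Site 2, Tendsto (fun j : ℕ => (∑ y ∈ halfOpenBox 2 (Ls j),
          torusPullback (pairFieldCorr dWaveFormFactor ψ) (Ls j) (x + y) y) / ((Ls j : ℕ) : ℝ) ^ 2)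
          atTop (𝓝 (C x))) →
        a ≤ liminf (fun R : ℕ => (∑ x ∈ halfOpenBox 2 R, ∑ y ∈ halfOpenBox 2 R, C (x - y)) /
          ((R : ℕ) : ℝ) ^ 4) atTop) := by
  rintro ⟨δ, hδ, a, ha, h⟩
  obtain ⟨U₁, hU₁, hT'⟩ := hT δ hδ
  have hc : (0 : ℝ) < a / 2 := by positivity
  have hstar : (0 : ℝ) < 4 * (min (a / 2) 1 / 48) ^ 6 := by positivity
  obtain ⟨U, hU, hfloor⟩ := h (min U₁ (4 * (min (a / 2) 1 / 48) ^ 6)) (lt_min hU₁ hstar)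
  have hδ1 : (-1 : ℝ) ≤ δ := by linarith [hδ.1]
  obtain ⟨N, ψ, hadm0⟩ :=
    Summit.HubbardSuperconductivity.NoGo.exists_groundStateInSector_seq 1 U δ hδ1
  have hadm : ∀ L, Even L → N L = 2 * ⌊(1 - δ) * (L : ℝ) ^ 2 / 2⌋₊ ∧ star (ψ L) ⬝ᵥ ψ L = 1 ∧
      IsGroundStateInSector (hubbardTorus 2 L 1 U) (N L) 0 (ψ L) := fun L _ => hadm0 L
  have htight := hT' U ⟨hU.1, hU.2.trans_le (min_le_left _ _)⟩ N ψ hadm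
  obtain ⟨Ls, C, hLs, heven, hconv⟩ := exists_convergent_subseq ψ fun L hL => (hadm L hL).2.1
  have hge := hfloor N ψ hadm Ls C hLs heven hconv
  have hle := liminf_boxAvg_le_of_small_coupling hc hU.1.le (hU.2.trans_le (min_le_right _ _)) hδ1
    hadm htight Ls C hLs heven hconv
  linarith

end Summit.HubbardSuperconductivity.HubbardSuperconductivity.Theorems.NoNormalLimitState.Negative

end
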